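import Summits.NavierStokesRegularity.NavierStokesRegularity.Theorems.SelfMixingDichotomyCoherentScaleExclusionSwirlCoherence
import Summits.NavierStokesRegularity.NavierStokesRegularity.Theorems.SelfMixingDichotomyCoherentScaleExclusionMixTranslate
import HarnessLib

/-!
# Route SelfMixingDichotomy — crux `CoherentScaleExclusion` (S2, stmt-NavierStokesRegularity-1423), line `registered`,
# lead c3: sphere-tangential drifts are coherent at every scale — general centre

Support file (`--supports stmt-NavierStokesRegularity-1423`; registered sub-goal
`stub_sphereTangential_notDissipatesAtScale_centre`). The amplitude-free coherence theorem
`stub_sphereTangential_notDissipatesAtScale` (file `…SwirlCoherence`: drifts with `⟪u(t,x), x⟫ = 0` on the window are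
non-`δ`-mixing at every scale about `0` for `δ ≤ δ₁`) moved to an arbitrary centre `x₀` by the translation invariance
of the MIX functional `stub_dissipatesAtScale_translate` (file `…MixTranslate`):
`DissipatesAtScale u T x₀ r δ ↔ DissipatesAtScale (fun t y => u t (y + x₀)) T 0 r δ`.
-/

noncomputable section

open Literature.Analysis.FluidPDE MeasureTheory Set Function Metric
open scoped ContDiff InnerProductSpace

-- `Summit = Problem` for this summit; the tree lakefile sets `weak.linter.dupNamespace = false`.
set_option linter.dupNamespace false

namespace Summit.NavierStokesRegularity.NavierStokesRegularity.Theorems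

/-- **SW0 at a general centre** (registered sub-goal `stub_sphereTangential_notDissipatesAtScale_centre`, lead c3).
There is a universal `δ₁ > 0` such that every drift tangential to the spheres about `x₀` on the window
`[T − r², T − r²/2]` (`⟪u(t,x), x − x₀⟫ = 0`; any amplitude, no regularity) satisfies `¬ DissipatesAtScale u T x₀ r δ`
for every `r > 0` and every `0 ≤ δ ≤ δ₁`: translate to the origin (`stub_dissipatesAtScale_translate`) and apply
`stub_sphereTangential_notDissipatesAtScale` to the translated drift, which is tangential about `0`. -/
theorem stub_sphereTangential_notDissipatesAtScale_centre :
    ∃ δ₁ : ℝ, 0 < δ₁ ∧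
      ∀ (u : ℝ → EuclideanSpace ℝ (Fin 3) → EuclideanSpace ℝ (Fin 3)) (T : ℝ) (x₀ : EuclideanSpace ℝ (Fin 3))
        (r : ℝ), 0 < r →
      (∀ t ∈ Set.Icc (T - r ^ 2) (T - r ^ 2 / 2), ∀ x : EuclideanSpace ℝ (Fin 3),
        inner ℝ (u t x) (x - x₀) = 0) →
      ∀ δ : ℝ, 0 ≤ δ → δ ≤ δ₁ → ¬ DissipatesAtScale u T x₀ r δ := by
  obtain ⟨δ₁, hδ₁, hSW⟩ := stub_sphereTangential_notDissipatesAtScale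
  refine ⟨δ₁, hδ₁, fun u T x₀ r hr htan δ hδ0 hδ1 hmix => ?_⟩
  rw [stub_dissipatesAtScale_translate] at hmix
  refine hSW (fun t y => u t (y + x₀)) T r hr (fun t ht y => ?_) δ hδ0 hδ1 hmix
  have h := htan t ht (y + x₀)
  rwa [add_sub_cancel_right] at h

end Summit.NavierStokesRegularity.NavierStokesRegularity.Theorems

end
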